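import Summits.Ventures.DiscreteObjects.Hadamard.LanderParity

/-!
# Hadamard 668 census, family F12 — Lander's parity theorem for the 2-(667,333,166) design at EVERY self-conjugate prime (kernel)

Framing: lottery ticket; floor = certified bounds/negative ranges.

Cell pub-namedobj (venture DiscreteObjects), target (H), hadamard gen 8.  `PrimeOrder29Parity` proved Lander's parity theorem
(Symmetric Designs: An Algebraic Approach, 1983, Thm 3.20(2)) in the kernel for `p = 29` and a fixed-point-free automorphism.
This file removes both restrictions: **`two_dvd_card_blockClasses_of_selfConj`** — for a `0/1` incidence function
`N : P → B → ℤ` with row/column sums `333` and row/column inner products `166`, ANY prime `p ≠ 167` such that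
`167^j ≡ -1 (mod p)` for some `j` ('`167` self-conjugate mod `p`'), and any automorphism pair `(ρ, τ)` with `ρ^p = τ^p = 1`,
the number of `τ`-classes of moved blocks is EVEN (fixed blocks allowed; no cardinality hypothesis on `P`, `B`).  It is
the instance `(k, λ, q) = (333, 166, 167)` of `LanderParity.two_dvd_card_blockClasses_general` (whose proof is that of
`PrimeOrder29Parity` with `Φ_p` for `Φ₂₉` (`ParityCyclotomicSelfConj`) and the dimension count with fixed points
(`ParityPermModuleFixed`)).  Corollary `two_dvd_card_blockClasses_of_mem`: the conclusion for
`p ∈ {2, 3, 5, 7, 11, 13, 37, 41}` (witnesses `j = 1, 1, 2, 1, 5, 6, 18, 4`), i.e. for every prime order that the census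
(line (4)) does not exclude except `23` and `83` (mod which `167` is not self-conjugate) — the 'Lander-admissible orbit number'
filter of the F12 landscape (FAMILY-F12-G5 §6–§7: `m` even for `p = 3, 5, 7, 11, 13, 37, 41`) is now a kernel fact, and for
`p = 2` it says an involutory automorphism pair has an even number of `2`-cycles on blocks.
Ours, not literature; no `sorry`; reference: [cite: book:lander1983-symmetric-designs-algebraic-approach, Thm 3.20(2) p.95].
-/

open Finset BigOperators

namespace Summit.Ventures.DiscreteObjects.Hadamard

variable {P B : Type*} [Fintype P] [DecidableEq P] [Fintype B] [DecidableEq B]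

/-- **Lander's parity theorem for (667,333,166), `q = 167`, any self-conjugate prime `p` (kernel).**  See the module
docstring; this is `two_dvd_card_blockClasses_general` with `(k, λ, q) = (333, 166, 167)`. -/
theorem two_dvd_card_blockClasses_of_selfConj (N : P → B → ℤ) (h01 : ∀ x y, N x y = 0 ∨ N x y = 1)
    (hrow : ∀ x, ∑ y, N x y = 333) (hpair : ∀ x x', x ≠ x' → ∑ y, N x y * N x' y = 166)
    (hcol : ∀ y, ∑ x, N x y = 333) (hcpair : ∀ y y', y ≠ y' → ∑ x, N x y * N x y' = 166)
    {p : ℕ} (hp : p.Prime) (hp167 : p ≠ 167) {j : ℕ} (hj : 167 ^ j % p = p - 1)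
    (ρ : Equiv.Perm P) (τ : Equiv.Perm B) (hN : ∀ x y, N (ρ x) (τ y) = N x y)
    (hρ : ρ ^ p = 1) (hτ : τ ^ p = 1) :
    2 ∣ (blockClasses τ p).card :=
  two_dvd_card_blockClasses_general N h01 (k := 333) (lam := 166) hrow hpair hcol hcpair (q := 167) (by norm_num)
    (by norm_num) (by norm_num) (by norm_num) hp hp167 hj ρ τ hN hρ hτ

/-- witnesses of self-conjugacy: `167^j ≡ -1 (mod p)` for the listed `(p, j)` -/
lemma selfConj_witnesses : ∀ pj ∈ [((2 : ℕ), (1 : ℕ)), (3, 1), (5, 2), (7, 1), (11, 5), (13, 6), (37, 18), (41, 4)],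
    167 ^ pj.2 % pj.1 = pj.1 - 1 := by
  decide

/-- **Corollary.** For `p ∈ {2, 3, 5, 7, 11, 13, 37, 41}` an automorphism pair of order dividing `p` of the 2-(667,333,166)
incidence structure has an even number of classes of moved blocks. -/
theorem two_dvd_card_blockClasses_of_mem (N : P → B → ℤ) (h01 : ∀ x y, N x y = 0 ∨ N x y = 1)
    (hrow : ∀ x, ∑ y, N x y = 333) (hpair : ∀ x x', x ≠ x' → ∑ y, N x y * N x' y = 166)
    (hcol : ∀ y, ∑ x, N x y = 333) (hcpair : ∀ y y', y ≠ y' → ∑ x, N x y * N x y' = 166)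
    {p : ℕ} (hmem : p = 2 ∨ p = 3 ∨ p = 5 ∨ p = 7 ∨ p = 11 ∨ p = 13 ∨ p = 37 ∨ p = 41)
    (ρ : Equiv.Perm P) (τ : Equiv.Perm B) (hN : ∀ x y, N (ρ x) (τ y) = N x y)
    (hρ : ρ ^ p = 1) (hτ : τ ^ p = 1) : 2 ∣ (blockClasses τ p).card := by
  rcases hmem with rfl | rfl | rfl | rfl | rfl | rfl | rfl | rfl
  · exact two_dvd_card_blockClasses_of_selfConj N h01 hrow hpair hcol hcpair (by norm_num) (by norm_num) (j := 1)
      (selfConj_witnesses (2, 1) (by simp)) ρ τ hN hρ hτ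
  · exact two_dvd_card_blockClasses_of_selfConj N h01 hrow hpair hcol hcpair (by norm_num) (by norm_num) (j := 1)
      (selfConj_witnesses (3, 1) (by simp)) ρ τ hN hρ hτ
  · exact two_dvd_card_blockClasses_of_selfConj N h01 hrow hpair hcol hcpair (by norm_num) (by norm_num) (j := 2)
      (selfConj_witnesses (5, 2) (by simp)) ρ τ hN hρ hτ
  · exact two_dvd_card_blockClasses_of_selfConj N h01 hrow hpair hcol hcpair (by norm_num) (by norm_num) (j := 1)
      (selfConj_witnesses (7, 1) (by simp)) ρ τ hN hρ hτ
  · exact two_dvd_card_blockClasses_of_selfConj N h01 hrow hpair hcol hcpair (by norm_num) (by norm_num) (j := 5)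
      (selfConj_witnesses (11, 5) (by simp)) ρ τ hN hρ hτ
  · exact two_dvd_card_blockClasses_of_selfConj N h01 hrow hpair hcol hcpair (by norm_num) (by norm_num) (j := 6)
      (selfConj_witnesses (13, 6) (by simp)) ρ τ hN hρ hτ
  · exact two_dvd_card_blockClasses_of_selfConj N h01 hrow hpair hcol hcpair (by norm_num) (by norm_num) (j := 18)
      (selfConj_witnesses (37, 18) (by simp)) ρ τ hN hρ hτ
  · exact two_dvd_card_blockClasses_of_selfConj N h01 hrow hpair hcol hcpair (by norm_num) (by norm_num) (j := 4)
      (selfConj_witnesses (41, 4) (by simp)) ρ τ hN hρ hτ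

end Summit.Ventures.DiscreteObjects.Hadamard
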